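import Literature.Topology.FourManifolds.TopologicalConnectedSumOrientation
import Literature.Topology.FourManifolds.TopologicalConnectedSumExistence
import Literature.Topology.FourManifolds.LatticeFormsOrthoSum
import Literature.AlgebraicTopology.SingularHomology.OrientationReversingHomeomorph
import Mathlib.Analysis.InnerProductSpace.Projection.FiniteDimensional
import HarnessLib

/-!
# The intersection form of a topological connected sum is the orthogonal sum (sign control)

Topic `Literature/Topology/FourManifolds`. Third file on topological connected sums, after
`TopologicalConnectedSumExistence.lean` (the glued space `M # N`) and
`TopologicalConnectedSumOrientation.lean` (the gluing maps are orientation preserving for `μN` or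
for `-μN`). Here the remaining sign is pinned: **for closed simply connected `ℤ`-oriented
topological 4-manifolds `(M, μM)`, `(N, μN)` there is a closed simply connected topological
connected sum `P = M # N` with an orientation `μP` under which `Q⟦μP⟧ ≅ Q⟦μM⟧ ⊥ Q⟦μN⟧`** — the
topological form of the tree's `exists_isConnectedSum_intersectionForm_equivalent_prod`
(`SmoothIntersectionFormsRealisationDiagonal.lean`), with no smooth structure anywhere
(M. Kervaire, J. Milnor, *Groups of homotopy spheres I* (1963), §2 p. 505: choose the second disc
orientation reversing; C. T. C. Wall, *On simply-connected 4-manifolds* (1964), §2 pp. 144–145;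
M. H. Freedman, F. Quinn, *Topology of 4-Manifolds* (1990), §10.3: "`W ≃ M # W'` inducing the
given decomposition of `π₂`").

How the sign is controlled (A. Hatcher, *Algebraic Topology* (2002), §3.3 pp. 233–236; G. Bredon,
*Topology and Geometry* (1993), VI.7): along a chart `c : X ⇀ ℝⁿ` every point carries a
*reference local class* (the tree's `(localHomology.chartXEquiv ℤ ℤ c hy n).symm (g (c y))`,
`ChartTransitionLocalDegree.lean`), and an orientation agrees with it or with its negative. The
glued space `P` of the connected-sum datum `(e₁, e₂)` has at a neck point `p₀` the two charts
`c_A` (from `e₁` through `jA`) and `c_B` (from `e₂` through `jB`) whose transition map is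
Kervaire–Milnor's inversion `ψ` of the punctured disc; at `v₀ = e₀/2` its Jacobian is the
reflection `h ↦ h - 2⟨e₀, h⟩ e₀`, of determinant `-1`, so the two reference classes at `p₀` are
opposite (`chartXEquiv_symm_localClass_eq_of_hasFDerivAt`). Reference classes are natural under
the open embeddings `jA`, `jB` (§1, the open-embedding form of the tree's
`chartXEquiv_transOpenPartialHomeomorph`), so "`μM` agrees with `e₁` at `i₁ v₀`" and "the
compatible orientation `μN'` of `N` agrees with `e₂` at `i₂ v₀`" are mutually exclusive; replacing
`e₂` by its composite with a reflection of `ℝⁿ` fixing `v₀` flips the second condition. Choosing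
`e₂` accordingly forces `μN' = μN` in `ConnectedSumNeck.exists_isOrientedLeft_isOrientedRight`.

## Main results (everything is proved; no named fact is introduced)

* §1 `localHomology.chartXEquiv_trans_of_source_eq_univ` — naturality of the chart
  identification `Hₙ(Y | y) ≃ Hₙ(ℝⁿ | c (j y))` under an open embedding `j : Y → X` given as a
  partial homeomorphism with `source = univ`.
* §2 `HomologicalOrientation.localClass_eq_chartXEquiv_symm_iff_of_map_eq` — if `j_* ν_y = μ_{j y}`
  then `ν` agrees with the reference class of `j ≫ c` at `y` iff `μ` agrees with that of `c` at
  `j y`.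
* §3 `neckBaseVec`, `neckReflection`, `sideReflection` (definitions with bodies: `e₀/2`, the
  reflections in `e₀^⊥` and `e₁^⊥`), `det_neckReflection = -1`, `det_sideReflection = -1`,
  `hasFDerivAt_discInversionFun_neckBaseVec` — the Jacobian of `ψ` at `e₀/2` is the reflection in
  `e₀^⊥`.
* §4–§5 `TopConnectedSumData.neck` (the constructed sum as a `ConnectedSumNeck`), `chartLeft`,
  `chartRight` (the two neck charts) and `chartRight_chartLeft_symm` — their transition is `ψ`.
* §6 `localClass_basePoint_eq_iff_left/right`, `right_agrees_iff_not_left_agrees` — along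
  orientation-preserving gluing maps, "`μM` agrees with `e₁` at `i₁ v₀`" and "`μN` agrees with
  `e₂` at `i₂ v₀`" are mutually exclusive.
* §7 `reflectRight` (the datum `(e₁, e₂ ≫ r)`), `reflectRight_agrees_iff` — reflecting the second
  chart flips the second condition.
* §8 `exists_data_isOrientedLeft_isOrientedRight` — connected compact `M`, `N` of dimension
  `m + 1 ≥ 2` with orientations `μM`, `μN` (and orientable glued spaces) have a connected-sum datum
  and an orientation `μP` of its glued space under which BOTH gluing maps are orientation
  preserving.
* §9 `exists_isTopConnectedSum_intersectionForm_equivalent_prod` — dimension `4`, `M`, `N`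
  closed simply connected: `Q⟦μP⟧ ≅ Q⟦μM⟧ ⊥ Q⟦μN⟧` (Mathlib's `LinearMap.BilinForm.Equivalent`,
  the tree's `prod`) on a closed simply connected topological connected sum `P`.

## References

* M. Kervaire, J. Milnor, *Groups of homotopy spheres I*, Ann. of Math. 77 (1963), §2 p. 505.
  [KervaireMilnorAnnals1963]
* C. T. C. Wall, *On simply-connected 4-manifolds*, J. London Math. Soc. 39 (1964), §2.
  [WallJLMS1964]
* A. Hatcher, *Algebraic Topology*, CUP 2002, §3.3 pp. 231–236. [HatcherAT2002]
* G. E. Bredon, *Topology and Geometry*, GTM 139 (1993), VI.7. [Bredon1993]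
* M. H. Freedman, F. Quinn, *Topology of 4-Manifolds* (1990), §10.2A, §10.3. [FreedmanQuinnPMS1990]
-/

open scoped Manifold Topology
open Set Function CategoryTheory TopologicalSpace Topology Metric OpenPartialHomeomorph
open Literature.AlgebraicTopology.SingularHomology

noncomputable section

universe u

namespace Literature.AlgebraicTopology.SingularHomology

/-! ### §1 Naturality of the chart identification under an open embedding -/

section Naturality

variable {n : ℕ} {X Y : Type u} [TopologicalSpace X] [T1Space X] [TopologicalSpace Y] [T1Space Y]

omit [T1Space X] [T1Space Y] in
/-- A partial homeomorphism with `source = univ`, as a continuous map. [folklore] -/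
theorem OpenPartialHomeomorph.continuous_of_source_eq_univ (j : OpenPartialHomeomorph Y X)
    (hs : j.source = univ) : Continuous j :=
  continuousOn_univ.1 (hs ▸ j.continuousOn)

/-- **Naturality of `Hₙ(· | ·) ≃ Hₙ(ℝⁿ | ·)` under an open embedding.** Let `j : Y ⇀ X` be a partial
homeomorphism with `source = univ` (an open embedding of `Y` onto the open set `j.target`) and
`c : X ⇀ ℝⁿ` a partial homeomorphism around `j y`. Then the identification along the composite
`j ≫ c` at `y` is `j_* : Hₖ(Y | y) → Hₖ(X | j y)` followed by the identification along `c` at `j y`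
(Hatcher 2002, §3.3 p. 231: local homology is natural for maps of pairs; the self-homeomorphism
case is the tree's `chartXEquiv_transOpenPartialHomeomorph`, whose proof is followed verbatim).
[cite: HatcherAT2002, §3.3 p. 231] -/
theorem localHomology.chartXEquiv_trans_of_source_eq_univ (j : OpenPartialHomeomorph Y X)
    (hs : j.source = univ) (c : OpenPartialHomeomorph X (EuclideanSpace ℝ (Fin n))) {y : Y}
    (hy : j y ∈ c.source) (k : ℕ) (z : localHomology ℤ ℤ Y y k) :
    localHomology.chartXEquiv ℤ ℤ (j.trans c)
        (show y ∈ (j.trans c).source by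
          rw [trans_source, hs, univ_inter]; exact hy) k z =
      localHomology.chartXEquiv ℤ ℤ c hy k
        (relativeSingularHomology.map ℤ ℤ ⟨j, j.continuous_of_source_eq_univ hs⟩
          (LocalFamily.mapsTo_compl_pt
            (fun a b h => j.injOn (hs ▸ mem_univ a) (hs ▸ mem_univ b) h) y)
          k z) := by
  set c₂ := j.trans c with hc₂
  have hy₂ : y ∈ c₂.source := by rw [hc₂, trans_source, hs, univ_inter]; exact hy
  have hjinj : Injective j := fun a b h => j.injOn (hs ▸ mem_univ a) (hs ▸ mem_univ b) h
  set jC : C(Y, X) := ⟨j, j.continuous_of_source_eq_univ hs⟩ with hjC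
  -- the maps of pairs `f = j| : (S₂, S₂ ∖ y) → (S, S ∖ j y)` and `g = incl : (T₂, …) → (T, …)`
  have hjc : Continuous j := j.continuous_of_source_eq_univ hs
  let f : C(↥c₂.source, ↥c.source) :=
    ⟨fun v => ⟨j v, v.2.2⟩, (hjc.comp continuous_subtype_val).subtype_mk _⟩
  let g : C(↥c₂.target, ↥c.target) :=
    ⟨fun v => ⟨(v : EuclideanSpace ℝ (Fin n)), v.2.1⟩, by fun_prop⟩
  have hf : MapsTo f {(⟨y, hy₂⟩ : ↥c₂.source)}ᶜ {(⟨j y, hy⟩ : ↥c.source)}ᶜ := by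
    intro v hv hv'
    apply hv
    rw [mem_singleton_iff] at hv' ⊢
    have e1 : j (v : Y) = j y := congrArg Subtype.val hv'
    exact Subtype.ext (hjinj e1)
  have hg : MapsTo g {c₂.toHomeomorphSourceTarget ⟨y, hy₂⟩}ᶜ
      {c.toHomeomorphSourceTarget ⟨j y, hy⟩}ᶜ := by
    intro v hv hv'
    apply hv
    rw [mem_singleton_iff] at hv' ⊢
    have e1 : (v : EuclideanSpace ℝ (Fin n)) = c (j y) := congrArg Subtype.val hv'
    exact Subtype.ext e1
  -- `exc_{S₂} ≫ j_* = f_* ≫ exc_S`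
  have hS : (localHomology.openSubsetIso ℤ ℤ c₂.open_source hy₂ k).hom ≫
      relativeSingularHomology.map ℤ ℤ jC (LocalFamily.mapsTo_compl_pt hjinj y) k =
      relativeSingularHomology.map ℤ ℤ f hf k ≫
        (localHomology.openSubsetIso ℤ ℤ c.open_source hy k).hom := by
    change relativeSingularHomology.map ℤ ℤ (subsetIncl c₂.source)
        (localHomology.mapsTo_subsetIncl_compl hy₂) k ≫
        relativeSingularHomology.map ℤ ℤ jC _ k =
      relativeSingularHomology.map ℤ ℤ f hf k ≫
        relativeSingularHomology.map ℤ ℤ (subsetIncl c.source)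
          (localHomology.mapsTo_subsetIncl_compl hy) k
    rw [← relativeSingularHomology.map_comp, ← relativeSingularHomology.map_comp]
    rfl
  have h1 : (localHomology.openSubsetIso ℤ ℤ c.open_source hy k).inv
      (relativeSingularHomology.map ℤ ℤ jC (LocalFamily.mapsTo_compl_pt hjinj y) k z) =
      relativeSingularHomology.map ℤ ℤ f hf k
        ((localHomology.openSubsetIso ℤ ℤ c₂.open_source hy₂ k).inv z) := by
    have e1 : ((localHomology.openSubsetIso ℤ ℤ c₂.open_source hy₂ k).hom ≫
        relativeSingularHomology.map ℤ ℤ jC (LocalFamily.mapsTo_compl_pt hjinj y) k)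
          ((localHomology.openSubsetIso ℤ ℤ c₂.open_source hy₂ k).inv z) =
        relativeSingularHomology.map ℤ ℤ jC (LocalFamily.mapsTo_compl_pt hjinj y) k z := by
      rw [ModuleCat.comp_apply, ← ModuleCat.comp_apply _ _ z, Iso.inv_hom_id, ModuleCat.id_apply]
    rw [← e1, hS, ModuleCat.comp_apply, ← ModuleCat.comp_apply _ (localHomology.openSubsetIso ℤ ℤ
      c.open_source hy k).inv, Iso.hom_inv_id, ModuleCat.id_apply]
  -- naturality of the cross-universe transport for the square `(f, g)`
  have hfg : ∀ v : ↥c₂.source, g (c₂.toHomeomorphSourceTarget v) =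
      c.toHomeomorphSourceTarget (f v) := fun v => Subtype.ext rfl
  have h2 := relativeSingularHomology.xEquiv_map ℤ ℤ c₂.toHomeomorphSourceTarget
    c.toHomeomorphSourceTarget f g hfg
    (A := {(⟨y, hy₂⟩ : ↥c₂.source)}ᶜ) (B := {c₂.toHomeomorphSourceTarget ⟨y, hy₂⟩}ᶜ)
    (mapsTo_compl_singleton c₂.toHomeomorphSourceTarget.toEquiv ⟨y, hy₂⟩)
    (mapsTo_symm_compl_singleton c₂.toHomeomorphSourceTarget.toEquiv ⟨y, hy₂⟩)
    (A₂ := {(⟨j y, hy⟩ : ↥c.source)}ᶜ) (B₂ := {c.toHomeomorphSourceTarget ⟨j y, hy⟩}ᶜ)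
    (mapsTo_compl_singleton c.toHomeomorphSourceTarget.toEquiv ⟨j y, hy⟩)
    (mapsTo_symm_compl_singleton c.toHomeomorphSourceTarget.toEquiv ⟨j y, hy⟩) hf hg k
    ((localHomology.openSubsetIso ℤ ℤ c₂.open_source hy₂ k).inv z)
  -- `g_* ≫ exc_T = exc_{T₂}`
  have hT : relativeSingularHomology.map ℤ ℤ g hg k ≫
      (localHomology.openSubsetIso ℤ ℤ c.open_target (c.map_source hy) k).hom =
      (localHomology.openSubsetIso ℤ ℤ c₂.open_target (c₂.map_source hy₂) k).hom :=
    (relativeSingularHomology.map_comp ℤ ℤ g (subsetIncl c.target) hg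
      (localHomology.mapsTo_subsetIncl_compl (c.map_source hy)) k).symm
  have e2 : (localHomology.openSubsetIso ℤ ℤ c.open_target (c.map_source hy) k).hom
      (localHomology.xEquiv ℤ ℤ c.toHomeomorphSourceTarget ⟨j y, hy⟩ k
        (relativeSingularHomology.map ℤ ℤ f hf k
          ((localHomology.openSubsetIso ℤ ℤ c₂.open_source hy₂ k).inv z))) =
      (localHomology.openSubsetIso ℤ ℤ c.open_target (c.map_source hy) k).hom
        (relativeSingularHomology.map ℤ ℤ g hg k
          (localHomology.xEquiv ℤ ℤ c₂.toHomeomorphSourceTarget ⟨y, hy₂⟩ k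
            ((localHomology.openSubsetIso ℤ ℤ c₂.open_source hy₂ k).inv z))) :=
    congrArg (fun v => (localHomology.openSubsetIso ℤ ℤ c.open_target (c.map_source hy) k).hom v)
      h2
  -- unfold both sides and assemble
  have eR : ∀ w, localHomology.chartXEquiv ℤ ℤ c hy k w =
      (localHomology.openSubsetIso ℤ ℤ c.open_target (c.map_source hy) k).hom
        (localHomology.xEquiv ℤ ℤ c.toHomeomorphSourceTarget ⟨j y, hy⟩ k
          ((localHomology.openSubsetIso ℤ ℤ c.open_source hy k).inv w)) := fun w => rfl
  have eL : localHomology.chartXEquiv ℤ ℤ c₂ hy₂ k z =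
      (localHomology.openSubsetIso ℤ ℤ c₂.open_target (c₂.map_source hy₂) k).hom
        (localHomology.xEquiv ℤ ℤ c₂.toHomeomorphSourceTarget ⟨y, hy₂⟩ k
          ((localHomology.openSubsetIso ℤ ℤ c₂.open_source hy₂ k).inv z)) := rfl
  rw [eR, h1, e2, eL, ← hT]
  rfl

end Naturality

/-! ### §2 Agreement with reference classes transfers along orientation-preserving embeddings -/

namespace HomologicalOrientation

variable {n : ℕ} {X Y : Type u} [TopologicalSpace X] [T1Space X] [TopologicalSpace Y] [T1Space Y]

/-- **Transfer of "agrees with the reference class".** Let `j : Y ⇀ X` have `source = univ`,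
`c : X ⇀ ℝⁿ` be a partial homeomorphism around `j y`, `g` a `ℤ`-orientation of `ℝⁿ` (generator
convention), and let `ν`, `μ` be `ℤ`-orientations of `Y`, `X` with `j_* ν_y = μ_{j y}` (the open
embedding is orientation preserving at `y`). Then `ν_y` is the reference class of the chart `j ≫ c`
at `y` iff `μ_{j y}` is the reference class of `c` at `j y` (Hatcher 2002, §3.3 p. 233: local
orientations along charts; naturality, `chartXEquiv_trans_of_source_eq_univ`).
[cite: HatcherAT2002, §3.3 pp. 231, 233] -/
theorem localClass_eq_chartXEquiv_symm_iff_of_map_eq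
    (g : HomologicalOrientation ℤ (EuclideanSpace ℝ (Fin n)) n)
    (j : OpenPartialHomeomorph Y X) (hs : j.source = univ)
    (c : OpenPartialHomeomorph X (EuclideanSpace ℝ (Fin n))) {y : Y} (hy : j y ∈ c.source)
    (ν : HomologicalOrientation ℤ Y n) (μ : HomologicalOrientation ℤ X n)
    (h : relativeSingularHomology.map ℤ ℤ ⟨j, j.continuous_of_source_eq_univ hs⟩
      (LocalFamily.mapsTo_compl_pt
        (fun a b h => j.injOn (hs ▸ mem_univ a) (hs ▸ mem_univ b) h) y) n (ν.localClass y) =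
      μ.localClass (j y)) :
    ν.localClass y = (localHomology.chartXEquiv ℤ ℤ (j.trans c)
        (show y ∈ (j.trans c).source by rw [trans_source, hs, univ_inter]; exact hy) n).symm
        (g.localClass ((j.trans c) y)) ↔
      μ.localClass (j y) =
        (localHomology.chartXEquiv ℤ ℤ c hy n).symm (g.localClass (c (j y))) := by
  have hy₂ : y ∈ (j.trans c).source := by rw [trans_source, hs, univ_inter]; exact hy
  rw [LinearEquiv.eq_symm_apply, LinearEquiv.eq_symm_apply,
    localHomology.chartXEquiv_trans_of_source_eq_univ j hs c hy n, h]
  rfl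

end HomologicalOrientation

/-! ### §2b Reference classes: congruences and the sign dichotomy -/

section RefClass

/-- Changing the chart along an equality of charts does not change the reference class.
[folklore] -/
theorem localHomology.chartXEquiv_symm_congr
    {n : ℕ} {X : Type} [TopologicalSpace X] [T1Space X]
    {c c' : OpenPartialHomeomorph X (EuclideanSpace ℝ (Fin n))} (h : c = c') {y : X}
    (hy : y ∈ c.source) (hy' : y ∈ c'.source)
    (g : HomologicalOrientation ℤ (EuclideanSpace ℝ (Fin n)) n) :
    (localHomology.chartXEquiv ℤ ℤ c hy n).symm (g.localClass (c y)) =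
      (localHomology.chartXEquiv ℤ ℤ c' hy' n).symm (g.localClass (c' y)) := by
  subst h
  rfl

/-- Moving the base point along an equality of points does not change "agrees with the reference
class". [folklore] -/
theorem HomologicalOrientation.agrees_congr_point
    {n : ℕ} {X : Type} [TopologicalSpace X] [T1Space X] (μ : HomologicalOrientation ℤ X n)
    (g : HomologicalOrientation ℤ (EuclideanSpace ℝ (Fin n)) n)
    (c : OpenPartialHomeomorph X (EuclideanSpace ℝ (Fin n))) {y y' : X} (h : y = y')
    (hy : y ∈ c.source) (hy' : y' ∈ c.source) :
    (μ.localClass y = (localHomology.chartXEquiv ℤ ℤ c hy n).symm (g.localClass (c y))) ↔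
      (μ.localClass y' = (localHomology.chartXEquiv ℤ ℤ c hy' n).symm (g.localClass (c y'))) := by
  subst h
  rfl

/-- For a `ℤ`-orientation, "`-μ` agrees with a reference class" is the negation of "`μ` agrees".
[folklore] -/
theorem HomologicalOrientation.neg_localClass_eq_iff
    {n : ℕ} {X : Type} [TopologicalSpace X] [T1Space X] (μ : HomologicalOrientation ℤ X n)
    (g : HomologicalOrientation ℤ (EuclideanSpace ℝ (Fin n)) n)
    (c : OpenPartialHomeomorph X (EuclideanSpace ℝ (Fin n))) {y : X} (hy : y ∈ c.source) :
    (-μ).localClass y = (localHomology.chartXEquiv ℤ ℤ c hy n).symm (g.localClass (c y)) ↔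
      ¬ μ.localClass y = (localHomology.chartXEquiv ℤ ℤ c hy n).symm (g.localClass (c y)) := by
  have hgen := isGenerator_chartXEquiv_symm_localClass g c hy (n := n)
  rw [HomologicalOrientation.neg_localClass, neg_eq_iff_eq_neg]
  constructor
  · intro h h'
    exact neg_ne_self_of_isGenerator hgen (h.symm.trans h')
  · intro h
    rcases eq_or_eq_neg_of_isGenerator (μ.isGenerator y) hgen with h' | h'
    · exact absurd h' h
    · exact h'

/-- The same dichotomy for a reference class replaced by its negative. [folklore] -/
theorem HomologicalOrientation.localClass_eq_neg_iff
    {n : ℕ} {X : Type} [TopologicalSpace X] [T1Space X] (μ : HomologicalOrientation ℤ X n)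
    (g : HomologicalOrientation ℤ (EuclideanSpace ℝ (Fin n)) n)
    (c : OpenPartialHomeomorph X (EuclideanSpace ℝ (Fin n))) {y : X} (hy : y ∈ c.source) :
    μ.localClass y = -(localHomology.chartXEquiv ℤ ℤ c hy n).symm (g.localClass (c y)) ↔
      ¬ μ.localClass y = (localHomology.chartXEquiv ℤ ℤ c hy n).symm (g.localClass (c y)) := by
  rw [← neg_eq_iff_eq_neg, ← HomologicalOrientation.neg_localClass]
  exact μ.neg_localClass_eq_iff g c hy

end RefClass

end Literature.AlgebraicTopology.SingularHomology

namespace Literature.Topology.FourManifolds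


/-! ### §3 The base vector `v₀ = e₀/2`, two reflections of `ℝᵐ⁺¹`, the Jacobian of `ψ` at `v₀` -/

section BaseVec

variable (m : ℕ)

/-- The first coordinate vector `e₀` of `ℝᵐ⁺¹`. [folklore] -/
def neckAxis : EuclideanSpace ℝ (Fin (m + 1)) := EuclideanSpace.single 0 1

/-- **The base point `v₀ = e₀ / 2` of the neck**: a fixed point of Kervaire–Milnor's inversion
`ψ (t u) = (1 - t) u` (`t = 1/2`). [folklore] -/
def neckBaseVec : EuclideanSpace ℝ (Fin (m + 1)) := (2⁻¹ : ℝ) • neckAxis m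

/-- `‖e₀‖ = 1`. [folklore] -/
@[simp] theorem norm_neckAxis : ‖neckAxis m‖ = 1 := by
  simp [neckAxis]

/-- `e₀ ≠ 0`. [folklore] -/
theorem neckAxis_ne_zero : neckAxis m ≠ 0 := by
  intro h
  have := norm_neckAxis m
  rw [h, norm_zero] at this
  exact zero_ne_one this

/-- `‖v₀‖ = 1/2`. [folklore] -/
@[simp] theorem norm_neckBaseVec : ‖neckBaseVec m‖ = 2⁻¹ := by
  rw [neckBaseVec, norm_smul, norm_neckAxis, mul_one, Real.norm_eq_abs, abs_of_pos (by norm_num)]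

/-- `v₀ ≠ 0`. [folklore] -/
theorem neckBaseVec_ne_zero : neckBaseVec m ≠ 0 := by
  rw [← norm_pos_iff, norm_neckBaseVec]; norm_num

/-- `0 < ‖v₀‖`. [folklore] -/
theorem norm_neckBaseVec_pos : 0 < ‖neckBaseVec m‖ := by rw [norm_neckBaseVec]; norm_num

/-- `‖v₀‖ < 1`. [folklore] -/
theorem norm_neckBaseVec_lt_one : ‖neckBaseVec m‖ < 1 := by rw [norm_neckBaseVec]; norm_num

/-- **`v₀` is a fixed point of `ψ`**: `ψ (e₀/2) = (1 - 1/2) e₀`.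
[cite: KervaireMilnorAnnals1963, §2 p. 505] -/
theorem discInversionFun_neckBaseVec : discInversionFun (neckBaseVec m) = neckBaseVec m := by
  rw [neckBaseVec, discInversionFun_smul (norm_neckAxis m) (by norm_num : (0 : ℝ) < 2⁻¹)]
  norm_num

/-- **The reflection of `ℝᵐ⁺¹` in the hyperplane `e₀^⊥`** (negating the first coordinate), as a
continuous linear map: the Jacobian of `ψ` at `v₀`. [folklore] -/
def neckReflection : EuclideanSpace ℝ (Fin (m + 1)) →L[ℝ] EuclideanSpace ℝ (Fin (m + 1)) :=
  (((ℝ ∙ neckAxis m)ᗮ).reflection.toContinuousLinearEquiv :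
    EuclideanSpace ℝ (Fin (m + 1)) →L[ℝ] EuclideanSpace ℝ (Fin (m + 1)))

/-- `R h = h - 2⟨e₀, h⟩ e₀`. [folklore] -/
theorem neckReflection_apply (h : EuclideanSpace ℝ (Fin (m + 1))) :
    neckReflection m h = h - (2 * inner ℝ (neckAxis m) h) • neckAxis m := by
  change ((ℝ ∙ neckAxis m)ᗮ).reflection h = _
  rw [Submodule.reflection_orthogonal_apply, Submodule.reflection_singleton_apply, norm_neckAxis]
  simp only [RCLike.ofReal_real_eq_id, id_eq, one_pow, div_one]
  module

/-- **`det R = -1`** (Mathlib's `Submodule.det_reflection`: the reflection in `K` has determinant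
`(-1) ^ dim Kᗮ`, here `Kᗮ = ℝ e₀`). [folklore] -/
theorem det_neckReflection :
    LinearMap.det (neckReflection m : EuclideanSpace ℝ (Fin (m + 1)) →ₗ[ℝ]
      EuclideanSpace ℝ (Fin (m + 1))) = -1 := by
  have h1 : (neckReflection m : EuclideanSpace ℝ (Fin (m + 1)) →ₗ[ℝ]
      EuclideanSpace ℝ (Fin (m + 1))) = ((ℝ ∙ neckAxis m)ᗮ).reflection.toLinearMap :=
    LinearMap.ext fun _ => rfl
  rw [h1, Submodule.det_reflection, Submodule.orthogonal_orthogonal,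
    finrank_span_singleton (neckAxis_ne_zero m), pow_one]

/-- The derivative of `y ↦ ‖y‖` away from `0` in a real inner product space:
`D‖·‖(x) = ‖x‖⁻¹ ⟨x, ·⟩`. [folklore] -/
theorem hasFDerivAt_norm_of_ne_zero' {E : Type*} [NormedAddCommGroup E] [InnerProductSpace ℝ E]
    {x : E} (hx : x ≠ 0) :
    HasFDerivAt (fun y : E => ‖y‖) (‖x‖⁻¹ • (innerSL ℝ x : E →L[ℝ] ℝ)) x := by
  have h1 : HasFDerivAt (fun y : E => ‖y‖ ^ 2) (2 • (innerSL ℝ x : E →L[ℝ] ℝ)) x :=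
    (hasStrictFDerivAt_norm_sq x).hasFDerivAt
  have hx2 : ‖x‖ ^ 2 ≠ 0 := by positivity
  have h3 : HasFDerivAt (fun y : E => Real.sqrt (‖y‖ ^ 2))
      ((1 / (2 * Real.sqrt (‖x‖ ^ 2))) • (2 • (innerSL ℝ x : E →L[ℝ] ℝ))) x :=
    (Real.hasDerivAt_sqrt hx2).comp_hasFDerivAt x h1
  simp only [Real.sqrt_sq_eq_abs, abs_norm] at h3
  refine h3.congr_fderiv ?_
  have : ‖x‖ ≠ 0 := norm_ne_zero_iff.2 hx
  ext v
  simp only [FunLike.coe_smul, Pi.smul_apply, innerSL_apply_apply, smul_eq_mul]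
  rw [nsmul_eq_mul, Nat.cast_ofNat]
  field_simp

/-- The derivative of `y ↦ ‖y‖⁻¹` away from `0`: `D(‖·‖⁻¹)(x) = -‖x‖⁻³ ⟨x, ·⟩`. [folklore] -/
theorem hasFDerivAt_inv_norm' {E : Type*} [NormedAddCommGroup E] [InnerProductSpace ℝ E]
    {x : E} (hx : x ≠ 0) :
    HasFDerivAt (fun y : E => ‖y‖⁻¹) ((-(‖x‖ ^ 3)⁻¹) • (innerSL ℝ x : E →L[ℝ] ℝ)) x := by
  have hx' : ‖x‖ ≠ 0 := norm_ne_zero_iff.2 hx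
  have h : HasFDerivAt (fun y : E => ‖y‖⁻¹)
      ((-(‖x‖ ^ 2)⁻¹) • (‖x‖⁻¹ • (innerSL ℝ x : E →L[ℝ] ℝ))) x :=
    (hasDerivAt_inv hx').comp_hasFDerivAt x (hasFDerivAt_norm_of_ne_zero' hx)
  refine h.congr_fderiv ?_
  rw [smul_smul]
  congr 1
  field_simp

/-- Off the origin, `ψ v = ‖v‖⁻¹ v - v`. [folklore] -/
theorem discInversionFun_eq_of_ne_zero {E : Type*} [NormedAddCommGroup E] [InnerProductSpace ℝ E]
    {v : E} (hv : v ≠ 0) : discInversionFun v = ‖v‖⁻¹ • v - v := by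
  have hv' : ‖v‖ ≠ 0 := norm_ne_zero_iff.2 hv
  rw [discInversionFun, sub_mul, one_mul, mul_inv_cancel₀ hv', sub_smul, one_smul]

/-- **The Jacobian of Kervaire–Milnor's inversion `ψ` at `v₀ = e₀/2` is the reflection in `e₀^⊥`**:
`Dψ(v) h = ‖v‖⁻¹ h - ‖v‖⁻³ ⟨v, h⟩ v - h`, which at `‖v₀‖ = 1/2`, `v₀ = e₀/2` is
`h - 2⟨e₀, h⟩ e₀`. [folklore] -/
theorem hasFDerivAt_discInversionFun_neckBaseVec :
    HasFDerivAt (discInversionFun : EuclideanSpace ℝ (Fin (m + 1)) → EuclideanSpace ℝ (Fin (m + 1)))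
      (neckReflection m) (neckBaseVec m) := by
  have hv := neckBaseVec_ne_zero m
  -- the derivative of `v ↦ ‖v‖⁻¹ v - v` at `v₀`
  have h1 := ((hasFDerivAt_inv_norm' hv).smul (hasFDerivAt_id (𝕜 := ℝ) (neckBaseVec m))).sub
    (hasFDerivAt_id (𝕜 := ℝ) (neckBaseVec m))
  -- `ψ` agrees with it near `v₀`
  have h2 : (discInversionFun : EuclideanSpace ℝ (Fin (m + 1)) → EuclideanSpace ℝ (Fin (m + 1)))
      =ᶠ[𝓝 (neckBaseVec m)] fun v => ‖v‖⁻¹ • v - v := by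
    filter_upwards [isOpen_compl_singleton.mem_nhds hv] with v hv
    exact discInversionFun_eq_of_ne_zero hv
  refine (h1.congr_of_eventuallyEq h2).congr_fderiv (ContinuousLinearMap.ext fun h => ?_)
  simp only [FunLike.coe_sub, FunLike.coe_add, Pi.sub_apply,
    Pi.add_apply, FunLike.coe_smul, Pi.smul_apply,
    ContinuousLinearMap.smulRight_apply, ContinuousLinearMap.coe_id', id_eq, innerSL_apply_apply,
    norm_neckBaseVec, neckReflection_apply]
  rw [neckBaseVec, real_inner_smul_left, smul_smul]
  norm_num
  module

/-- The second coordinate vector `e₁` of `ℝᵐ⁺¹` (`m ≥ 1`). [folklore] -/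
def sideAxis : EuclideanSpace ℝ (Fin (m + 1)) := EuclideanSpace.single 1 1

/-- `‖e₁‖ = 1`. [folklore] -/
@[simp] theorem norm_sideAxis : ‖sideAxis m‖ = 1 := by
  simp [sideAxis]

/-- `e₁ ≠ 0`. [folklore] -/
theorem sideAxis_ne_zero : sideAxis m ≠ 0 := by
  intro h
  have := norm_sideAxis m
  rw [h, norm_zero] at this
  exact zero_ne_one this

variable {m} in
/-- `e₀ ⊥ e₁` for `m ≥ 1`. [folklore] -/
theorem inner_sideAxis_neckAxis (hm : 1 ≤ m) : inner ℝ (sideAxis m) (neckAxis m) = 0 := by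
  have h10 : (1 : Fin (m + 1)) ≠ 0 := by
    rw [Ne, Fin.ext_iff, Fin.val_one', Fin.val_zero]
    rw [Nat.mod_eq_of_lt (by omega)]
    exact one_ne_zero
  rw [sideAxis, neckAxis, EuclideanSpace.inner_single_left]
  simp [h10]

/-- **The reflection of `ℝᵐ⁺¹` in the hyperplane `e₁^⊥`** (negating the second coordinate): it
fixes `e₀`, hence the base point `v₀`, and has determinant `-1`. [folklore] -/
def sideReflection : EuclideanSpace ℝ (Fin (m + 1)) ≃ₗᵢ[ℝ] EuclideanSpace ℝ (Fin (m + 1)) :=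
  ((ℝ ∙ sideAxis m)ᗮ).reflection

/-- `det = -1` for the side reflection. [folklore] -/
theorem det_sideReflection :
    LinearMap.det ((sideReflection m).toContinuousLinearEquiv :
      EuclideanSpace ℝ (Fin (m + 1)) →L[ℝ] EuclideanSpace ℝ (Fin (m + 1))).toLinearMap = -1 := by
  have h1 : ((sideReflection m).toContinuousLinearEquiv :
      EuclideanSpace ℝ (Fin (m + 1)) →L[ℝ] EuclideanSpace ℝ (Fin (m + 1))).toLinearMap =
      ((ℝ ∙ sideAxis m)ᗮ).reflection.toLinearMap :=
    LinearMap.ext fun _ => rfl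
  rw [h1, Submodule.det_reflection, Submodule.orthogonal_orthogonal,
    finrank_span_singleton (sideAxis_ne_zero m), pow_one]

variable {m} in
/-- The side reflection fixes the base point `v₀ = e₀/2` (`m ≥ 1`). [folklore] -/
theorem sideReflection_neckBaseVec (hm : 1 ≤ m) :
    sideReflection m (neckBaseVec m) = neckBaseVec m := by
  apply Submodule.reflection_mem_subspace_eq_self
  rw [neckBaseVec, Submodule.mem_orthogonal_singleton_iff_inner_right, inner_smul_right,
    inner_sideAxis_neckAxis hm, mul_zero]

/-- The side reflection is an involution. [folklore] -/
theorem sideReflection_sideReflection (v : EuclideanSpace ℝ (Fin (m + 1))) :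
    sideReflection m (sideReflection m v) = v :=
  Submodule.reflection_reflection _ v

/-- The side reflection is its own inverse. [folklore] -/
theorem sideReflection_symm : (sideReflection m).symm = sideReflection m :=
  Submodule.reflection_symm

end BaseVec

/-! ### §4 The gluing data of the constructed connected sum -/

namespace TopConnectedSumData

variable {m : ℕ} {M N : Type} [TopologicalSpace M] [T2Space M] [TopologicalSpace N] [T2Space N]
  (D : TopConnectedSumData (m + 1) M N)

/-- **The gluing data of the constructed connected sum.** The glued space
`(D.glueData _).Glued` of a topological connected-sum datum `D = (e₁, e₂)` in positive dimension,
with its two open pieces `inl : M ∖ {i₁ 0} → M # N`, `inr : N ∖ {i₂ 0} → M # N`, is a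
`ConnectedSumNeck` in the sense of `HomotopySpheresSum.lean` / `ConnectedSumCohomology.lean`
(Kervaire–Milnor 1963, §2 p. 505). [cite: KervaireMilnorAnnals1963, §2 p. 505] -/
def neck : ConnectedSumNeck (m + 1) M N (D.glueData m.succ_ne_zero).Glued where
  i₁ := D.i₁
  i₂ := D.i₂
  jA := (D.glueData m.succ_ne_zero).inl
  jB := (D.glueData m.succ_ne_zero).inr
  continuous_i₁ := D.continuous_i₁
  injective_i₁ := D.isOpenEmbedding_i₁.injective
  continuous_i₂ := D.continuous_i₂
  injective_i₂ := D.isOpenEmbedding_i₂.injective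
  isEmbedding_jA := (D.glueData m.succ_ne_zero).isOpenEmbedding_inl.isEmbedding
  isEmbedding_jB := (D.glueData m.succ_ne_zero).isOpenEmbedding_inr.isEmbedding
  isOpen_range_jA := (D.glueData m.succ_ne_zero).isOpen_range_inl
  isOpen_range_jB := (D.glueData m.succ_ne_zero).isOpen_range_inr
  union_range := (D.glueData m.succ_ne_zero).range_inl_union_range_inr
  rel a b := (D.glueData m.succ_ne_zero).inl_eq_inr_iff.trans
    (D.connectedSumRel_iff_φ m.succ_ne_zero a b).symm

/-- The discs of the neck are those of the datum. [folklore] -/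
@[simp] theorem neck_i₁ : D.neck.i₁ = D.i₁ := rfl

/-- The discs of the neck are those of the datum. [folklore] -/
@[simp] theorem neck_i₂ : D.neck.i₂ = D.i₂ := rfl

/-- The gluing maps of the neck are `inl`, `inr`. [folklore] -/
@[simp] theorem neck_jA : D.neck.jA = (D.glueData m.succ_ne_zero).inl := rfl

/-- The gluing maps of the neck are `inl`, `inr`. [folklore] -/
@[simp] theorem neck_jB : D.neck.jB = (D.glueData m.succ_ne_zero).inr := rfl

/-! ### §5 The two charts of the glued space along the neck -/

/-- The chart `e₁` restricted to the open piece `M ∖ {i₁ 0}`. [folklore] -/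
def chartU : OpenPartialHomeomorph D.A (EuclideanSpace ℝ (Fin (m + 1))) :=
  D.e₁.subtypeRestr (D.nonempty_A m.succ_ne_zero)

/-- The chart `e₂` restricted to the open piece `N ∖ {i₂ 0}`. [folklore] -/
def chartV : OpenPartialHomeomorph D.B (EuclideanSpace ℝ (Fin (m + 1))) :=
  D.e₂.subtypeRestr (D.nonempty_B m.succ_ne_zero)

/-- **The chart of `M # N` induced by `e₁`** (through the first open piece). [folklore] -/
def chartLeft : OpenPartialHomeomorph (D.glueData m.succ_ne_zero).Glued
    (EuclideanSpace ℝ (Fin (m + 1))) :=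
  (D.glueData m.succ_ne_zero).chartA D.chartU

/-- **The chart of `M # N` induced by `e₂`** (through the second open piece). [folklore] -/
def chartRight : OpenPartialHomeomorph (D.glueData m.succ_ne_zero).Glued
    (EuclideanSpace ℝ (Fin (m + 1))) :=
  (D.glueData m.succ_ne_zero).chartB D.chartV

/-- `chartLeft (inl a) = e₁ a`. [folklore] -/
@[simp] theorem chartLeft_apply_inl (a : D.A) :
    D.chartLeft ((D.glueData m.succ_ne_zero).inl a) = D.e₁ a := by
  rw [chartLeft, TopGlueData.chartA_apply_inl]
  rfl

/-- `chartRight (inr b) = e₂ b`. [folklore] -/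
@[simp] theorem chartRight_apply_inr (b : D.B) :
    D.chartRight ((D.glueData m.succ_ne_zero).inr b) = D.e₂ b := by
  rw [chartRight, TopGlueData.chartB_apply_inr]
  rfl

/-- Points `inl a` with `a` in the domain of `e₁` lie in the source of `chartLeft`. [folklore] -/
theorem inl_mem_chartLeft_source {a : D.A} (ha : (a : M) ∈ D.e₁.source) :
    (D.glueData m.succ_ne_zero).inl a ∈ D.chartLeft.source :=
  ⟨a, by rw [chartU, subtypeRestr_source]; exact ha, rfl⟩

/-- Points `inr b` with `b` in the domain of `e₂` lie in the source of `chartRight`. [folklore] -/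
theorem inr_mem_chartRight_source {b : D.B} (hb : (b : N) ∈ D.e₂.source) :
    (D.glueData m.succ_ne_zero).inr b ∈ D.chartRight.source :=
  ⟨b, by rw [chartV, subtypeRestr_source]; exact hb, rfl⟩

/-- `chartLeft⁻¹ = inl ∘ chartU⁻¹`. [folklore] -/
theorem chartLeft_symm_apply (w : EuclideanSpace ℝ (Fin (m + 1))) :
    D.chartLeft.symm w = (D.glueData m.succ_ne_zero).inl (D.chartU.symm w) := rfl

/-- `chartRight⁻¹ = inr ∘ chartV⁻¹`. [folklore] -/
theorem chartRight_symm_apply (w : EuclideanSpace ℝ (Fin (m + 1))) :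
    D.chartRight.symm w = (D.glueData m.succ_ne_zero).inr (D.chartV.symm w) := rfl

omit [T2Space N] in
/-- Nonzero vectors lie in the target of `chartU` (the image of the punctured piece under `e₁`,
which is onto `ℝⁿ`). [folklore] -/
theorem mem_chartU_target {w : EuclideanSpace ℝ (Fin (m + 1))} (hw : w ≠ 0) :
    w ∈ D.chartU.target := by
  rw [chartU, subtypeRestr_def, trans_target, D.target₁, univ_inter, mem_preimage,
    TopologicalSpace.Opens.openPartialHomeomorphSubtypeCoe_target]
  change D.i₁ w ∈ (D.A : Set M)
  rw [SetLike.mem_coe, mem_puncture]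
  exact fun h => hw (D.isOpenEmbedding_i₁.injective h)

omit [T2Space M] in
/-- Nonzero vectors lie in the target of `chartV`. [folklore] -/
theorem mem_chartV_target {w : EuclideanSpace ℝ (Fin (m + 1))} (hw : w ≠ 0) :
    w ∈ D.chartV.target := by
  rw [chartV, subtypeRestr_def, trans_target, D.target₂, univ_inter, mem_preimage,
    TopologicalSpace.Opens.openPartialHomeomorphSubtypeCoe_target]
  change D.i₂ w ∈ (D.B : Set N)
  rw [SetLike.mem_coe, mem_puncture]
  exact fun h => hw (D.isOpenEmbedding_i₂.injective h)

omit [T2Space N] in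
/-- `chartU⁻¹ w = i₁ w` (as a point of `M`) for `w ≠ 0`. [folklore] -/
theorem coe_chartU_symm {w : EuclideanSpace ℝ (Fin (m + 1))} (hw : w ≠ 0) :
    ((D.chartU.symm w : D.A) : M) = D.i₁ w :=
  D.e₁.subtypeRestr_symm_apply (D.nonempty_A m.succ_ne_zero) (D.mem_chartU_target hw)

omit [T2Space M] in
/-- `chartV⁻¹ w = i₂ w` (as a point of `N`) for `w ≠ 0`. [folklore] -/
theorem coe_chartV_symm {w : EuclideanSpace ℝ (Fin (m + 1))} (hw : w ≠ 0) :
    ((D.chartV.symm w : D.B) : N) = D.i₂ w :=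
  D.e₂.subtypeRestr_symm_apply (D.nonempty_B m.succ_ne_zero) (D.mem_chartV_target hw)

/-- A point of the punctured open unit disc of the first piece lies in the gluing region.
[folklore] -/
theorem chartU_symm_mem_φ_source {w : EuclideanSpace ℝ (Fin (m + 1))} (h0 : 0 < ‖w‖)
    (h1 : ‖w‖ < 1) : D.chartU.symm w ∈ (D.φ m.succ_ne_zero).source := by
  have hw : w ≠ 0 := norm_pos_iff.1 h0
  rw [D.mem_φ_source, D.coe_chartU_symm hw, D.mem_Φ_source, D.e₁_i₁]
  exact ⟨D.i₁_mem w, h0, h1⟩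

/-- **The transition map between the two neck charts is Kervaire–Milnor's inversion**: on the
punctured open unit disc, `chartRight ∘ chartLeft⁻¹ = ψ` (`inl (i₁ w) = inr (i₂ (ψ w))` and
`e₂ ∘ i₂ = id`). [cite: KervaireMilnorAnnals1963, §2 p. 505] -/
theorem chartRight_chartLeft_symm {w : EuclideanSpace ℝ (Fin (m + 1))} (h0 : 0 < ‖w‖)
    (h1 : ‖w‖ < 1) : D.chartRight (D.chartLeft.symm w) = discInversionFun w := by
  have hw : w ≠ 0 := norm_pos_iff.1 h0
  have ha := D.chartU_symm_mem_φ_source h0 h1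
  rw [chartLeft_symm_apply, ← (D.glueData m.succ_ne_zero).inr_glue ha]
  change D.chartRight ((D.glueData m.succ_ne_zero).inr (D.φ m.succ_ne_zero (D.chartU.symm w))) = _
  rw [chartRight_apply_inr, D.coe_φ m.succ_ne_zero ha, Φ_apply, D.e₂_i₂, D.coe_chartU_symm hw,
    D.e₁_i₁]

/-- Symmetrically, `chartLeft ∘ chartRight⁻¹ = ψ` on the punctured open unit disc (`ψ` is an
involution). [cite: KervaireMilnorAnnals1963, §2 p. 505] -/
theorem chartLeft_chartRight_symm {w : EuclideanSpace ℝ (Fin (m + 1))} (h0 : 0 < ‖w‖)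
    (h1 : ‖w‖ < 1) : D.chartLeft (D.chartRight.symm w) = discInversionFun w := by
  have hw : w ≠ 0 := norm_pos_iff.1 h0
  -- `w = ψ w'` with `w' = ψ w` in the punctured disc
  have hn' : ‖discInversionFun w‖ = 1 - ‖w‖ := norm_discInversionFun hw h1.le
  have h0' : 0 < ‖discInversionFun w‖ := by rw [hn']; linarith
  have h1' : ‖discInversionFun w‖ < 1 := by rw [hn']; linarith
  have hψψ : discInversionFun (discInversionFun w) = w := discInversionFun_discInversionFun hw h1
  have key := D.chartRight_chartLeft_symm h0' h1'
  rw [hψψ] at key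
  -- apply `chartLeft ∘ chartRight⁻¹` to `key`
  have hsrc : D.chartLeft.symm (discInversionFun w) ∈ D.chartRight.source := by
    rw [chartLeft_symm_apply, ← (D.glueData m.succ_ne_zero).inr_glue
      (D.chartU_symm_mem_φ_source h0' h1')]
    refine D.inr_mem_chartRight_source ?_
    change ((D.φ m.succ_ne_zero (D.chartU.symm (discInversionFun w)) : D.B) : N) ∈ D.e₂.source
    rw [D.coe_φ m.succ_ne_zero (D.chartU_symm_mem_φ_source h0' h1')]
    exact (D.mem_Φ_target.1 (D.Φ.map_source ((D.mem_φ_source m.succ_ne_zero).1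
      (D.chartU_symm_mem_φ_source h0' h1')))).1
  have htgt : discInversionFun w ∈ D.chartLeft.target := by
    change discInversionFun w ∈ D.chartU.target
    exact D.mem_chartU_target (norm_pos_iff.1 h0')
  calc D.chartLeft (D.chartRight.symm w)
      = D.chartLeft (D.chartRight.symm (D.chartRight (D.chartLeft.symm (discInversionFun w)))) := by
        rw [key]
    _ = D.chartLeft (D.chartLeft.symm (discInversionFun w)) := by
        rw [D.chartRight.left_inv hsrc]
    _ = discInversionFun w := D.chartLeft.right_inv htgt

/-! ### §6 The base point of the neck; signs of the orientations along the two charts -/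

/-- The base point `a₀ = i₁ v₀` of the first open piece. [folklore] -/
def baseA : D.A :=
  ⟨D.i₁ (neckBaseVec m), D.ne_center₁ (D.i₁_mem _) (by
    rw [D.e₁_i₁]; exact neckBaseVec_ne_zero m)⟩

omit [T2Space N] in
/-- `a₀ = i₁ v₀` as a point of `M`. [folklore] -/
@[simp] theorem coe_baseA : (D.baseA : M) = D.i₁ (neckBaseVec m) := rfl

/-- `a₀` lies in the gluing region. [folklore] -/
theorem baseA_mem_φ_source : D.baseA ∈ (D.φ m.succ_ne_zero).source := by
  rw [D.mem_φ_source, coe_baseA, D.mem_Φ_source, D.e₁_i₁]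
  exact ⟨D.i₁_mem _, norm_neckBaseVec_pos m, norm_neckBaseVec_lt_one m⟩

/-- The base point `b₀ = φ a₀` of the second open piece. [folklore] -/
def baseB : D.B := D.φ m.succ_ne_zero D.baseA

/-- `b₀ = i₂ v₀` as a point of `N` (`ψ v₀ = v₀`). [folklore] -/
@[simp] theorem coe_baseB : (D.baseB : N) = D.i₂ (neckBaseVec m) := by
  rw [baseB, D.coe_φ m.succ_ne_zero D.baseA_mem_φ_source, Φ_apply, coe_baseA, D.e₁_i₁,
    discInversionFun_neckBaseVec]

/-- **The base point `p₀ = inl a₀ = inr b₀` of the neck of `M # N`.** [folklore] -/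
def basePoint : (D.glueData m.succ_ne_zero).Glued := (D.glueData m.succ_ne_zero).inl D.baseA

/-- `p₀ = inr b₀`. [folklore] -/
theorem inr_baseB : (D.glueData m.succ_ne_zero).inr D.baseB = D.basePoint :=
  (D.glueData m.succ_ne_zero).inr_glue D.baseA_mem_φ_source

/-- `p₀` lies in the source of the left chart. [folklore] -/
theorem basePoint_mem_chartLeft_source : D.basePoint ∈ D.chartLeft.source :=
  D.inl_mem_chartLeft_source (by rw [coe_baseA]; exact D.i₁_mem _)

/-- `p₀` lies in the source of the right chart. [folklore] -/
theorem basePoint_mem_chartRight_source : D.basePoint ∈ D.chartRight.source := by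
  rw [← inr_baseB]
  exact D.inr_mem_chartRight_source (by rw [coe_baseB]; exact D.i₂_mem _)

/-- The left chart sends `p₀` to `v₀`. [folklore] -/
@[simp] theorem chartLeft_basePoint : D.chartLeft D.basePoint = neckBaseVec m := by
  rw [basePoint, chartLeft_apply_inl, coe_baseA, D.e₁_i₁]

/-- The right chart sends `p₀` to `v₀`. [folklore] -/
@[simp] theorem chartRight_basePoint : D.chartRight D.basePoint = neckBaseVec m := by
  rw [← inr_baseB, chartRight_apply_inr, coe_baseB, D.e₂_i₂]

/-- **At the base point, the transition `chartLeft ∘ chartRight⁻¹` has Jacobian the reflection in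
`e₀^⊥`.** [folklore] -/
theorem hasFDerivAt_chartLeft_chartRight_symm :
    HasFDerivAt (fun v => D.chartLeft (D.chartRight.symm v)) (neckReflection m)
      (D.chartRight D.basePoint) := by
  rw [chartRight_basePoint]
  refine (hasFDerivAt_discInversionFun_neckBaseVec m).congr_of_eventuallyEq ?_
  have hO : IsOpen {w : EuclideanSpace ℝ (Fin (m + 1)) | 0 < ‖w‖ ∧ ‖w‖ < 1} :=
    (isOpen_lt continuous_const continuous_norm).inter (isOpen_lt continuous_norm continuous_const)
  filter_upwards [hO.mem_nhds ⟨norm_neckBaseVec_pos m, norm_neckBaseVec_lt_one m⟩] with w hw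
  exact D.chartLeft_chartRight_symm hw.1 hw.2

/-- The glued space is Hausdorff (as an instance, for the orientation lemmas below). [folklore] -/
instance t2Space_glued : T2Space (D.glueData m.succ_ne_zero).Glued :=
  (D.glueData m.succ_ne_zero).t2Space_of_isClosed_graph (D.isClosed_graph_φ m.succ_ne_zero)

/-- The glued space of compact summands is compact (instance). [folklore] -/
instance compactSpace_glued [CompactSpace M] [CompactSpace N] :
    CompactSpace (D.glueData m.succ_ne_zero).Glued :=
  (D.glueData m.succ_ne_zero).compactSpace_of_forall_not_mem D.isCompact_K₁ D.isCompact_K₂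
    (fun _ ha => D.φ_mem_K₂ m.succ_ne_zero ha) fun _ hb => D.φ_symm_mem_K₁ m.succ_ne_zero hb

/-- **The two reference classes at the base point are opposite**: the transition between the
two neck charts is `ψ`, of Jacobian determinant `-1` at `v₀` (Bredon 1993, VI.7: change of chart
acts by the sign of the Jacobian; the tree's `chartXEquiv_symm_localClass_eq_of_hasFDerivAt`).
[cite: Bredon1993, VI.7] -/
theorem chartXEquiv_symm_chartRight_eq_neg
    (g : HomologicalOrientation ℤ (EuclideanSpace ℝ (Fin (m + 1))) (m + 1)) :
    (localHomology.chartXEquiv ℤ ℤ D.chartRight D.basePoint_mem_chartRight_source (m + 1)).symm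
        (g.localClass (D.chartRight D.basePoint)) =
      -(localHomology.chartXEquiv ℤ ℤ D.chartLeft D.basePoint_mem_chartLeft_source (m + 1)).symm
        (g.localClass (D.chartLeft D.basePoint)) := by
  have hdet : LinearMap.det (neckReflection m : EuclideanSpace ℝ (Fin (m + 1)) →ₗ[ℝ]
      EuclideanSpace ℝ (Fin (m + 1))) ≠ 0 := by rw [det_neckReflection]; norm_num
  have key := chartXEquiv_symm_localClass_eq_of_hasFDerivAt g D.chartLeft D.chartRight
    D.basePoint_mem_chartLeft_source D.basePoint_mem_chartRight_source
    D.hasFDerivAt_chartLeft_chartRight_symm hdet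
  rw [det_neckReflection, if_neg (by norm_num)] at key
  exact key

section Signs

variable [ChartedSpace (EuclideanSpace ℝ (Fin (m + 1))) M]
  [ChartedSpace (EuclideanSpace ℝ (Fin (m + 1))) N]

/-- `inl` as a partial homeomorphism from the first open piece onto its (open) range. [folklore] -/
def inlPH : OpenPartialHomeomorph D.A (D.glueData m.succ_ne_zero).Glued :=
  haveI := D.nonempty_A m.succ_ne_zero
  (D.glueData m.succ_ne_zero).isOpenEmbedding_inl.toOpenPartialHomeomorph _

/-- `inr` as a partial homeomorphism from the second open piece onto its range. [folklore] -/
def inrPH : OpenPartialHomeomorph D.B (D.glueData m.succ_ne_zero).Glued :=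
  haveI := D.nonempty_B m.succ_ne_zero
  (D.glueData m.succ_ne_zero).isOpenEmbedding_inr.toOpenPartialHomeomorph _

omit [ChartedSpace (EuclideanSpace ℝ (Fin (m + 1))) M]
  [ChartedSpace (EuclideanSpace ℝ (Fin (m + 1))) N] in
/-- `inlPH` has source `univ`. [folklore] -/
@[simp] theorem inlPH_source : D.inlPH.source = univ := by
  haveI := D.nonempty_A m.succ_ne_zero
  exact IsOpenEmbedding.toOpenPartialHomeomorph_source _ _

omit [ChartedSpace (EuclideanSpace ℝ (Fin (m + 1))) M]
  [ChartedSpace (EuclideanSpace ℝ (Fin (m + 1))) N] in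
/-- `inrPH` has source `univ`. [folklore] -/
@[simp] theorem inrPH_source : D.inrPH.source = univ := by
  haveI := D.nonempty_B m.succ_ne_zero
  exact IsOpenEmbedding.toOpenPartialHomeomorph_source _ _

omit [ChartedSpace (EuclideanSpace ℝ (Fin (m + 1))) M]
  [ChartedSpace (EuclideanSpace ℝ (Fin (m + 1))) N] in
/-- **The pulled-back chart `inl ≫ chartLeft` is `chartU`** (`chartLeft` is the lift of `chartU`
along `inl`). [folklore] -/
theorem inlPH_trans_chartLeft : D.inlPH.trans D.chartLeft = D.chartU := by
  haveI := D.nonempty_A m.succ_ne_zero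
  refine OpenPartialHomeomorph.ext _ _ (fun a => ?_) (fun w => ?_) ?_
  · change D.chartLeft ((D.glueData m.succ_ne_zero).inl a) = _
    rw [chartLeft_apply_inl]
    rfl
  · change D.inlPH.symm (D.chartLeft.symm w) = _
    rw [chartLeft_symm_apply]
    exact IsOpenEmbedding.toOpenPartialHomeomorph_left_inv _ _
  · rw [trans_source, inlPH_source, univ_inter]
    ext a
    change (D.glueData m.succ_ne_zero).inl a ∈
      (D.glueData m.succ_ne_zero).inl '' D.chartU.source ↔ _
    exact (D.glueData m.succ_ne_zero).inl_injective.mem_set_image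

omit [ChartedSpace (EuclideanSpace ℝ (Fin (m + 1))) M]
  [ChartedSpace (EuclideanSpace ℝ (Fin (m + 1))) N] in
/-- **The pulled-back chart `inr ≫ chartRight` is `chartV`.** [folklore] -/
theorem inrPH_trans_chartRight : D.inrPH.trans D.chartRight = D.chartV := by
  haveI := D.nonempty_B m.succ_ne_zero
  refine OpenPartialHomeomorph.ext _ _ (fun b => ?_) (fun w => ?_) ?_
  · change D.chartRight ((D.glueData m.succ_ne_zero).inr b) = _
    rw [chartRight_apply_inr]
    rfl
  · change D.inrPH.symm (D.chartRight.symm w) = _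
    rw [chartRight_symm_apply]
    exact IsOpenEmbedding.toOpenPartialHomeomorph_left_inv _ _
  · rw [trans_source, inrPH_source, univ_inter]
    ext b
    change (D.glueData m.succ_ne_zero).inr b ∈
      (D.glueData m.succ_ne_zero).inr '' D.chartV.source ↔ _
    exact (D.glueData m.succ_ne_zero).inr_injective.mem_set_image

omit [ChartedSpace (EuclideanSpace ℝ (Fin (m + 1))) N] in
/-- **Sign transfer along the first gluing map.** If `jA = inl` is orientation preserving from
`(M, μM)` to `(M # N, μP)`, then `μP` agrees with the reference class of `chartLeft` at `p₀` iff
`μM` agrees with the reference class of `e₁` at `i₁ v₀`. [cite: HatcherAT2002, §3.3 pp. 231–236] -/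
theorem localClass_basePoint_eq_iff_left
    (g : HomologicalOrientation ℤ (EuclideanSpace ℝ (Fin (m + 1))) (m + 1))
    (μM : HomologicalOrientation ℤ M (m + 1))
    (μP : HomologicalOrientation ℤ (D.glueData m.succ_ne_zero).Glued (m + 1))
    (hL : D.neck.IsOrientedLeft μM μP) :
    μP.localClass D.basePoint =
        (localHomology.chartXEquiv ℤ ℤ D.chartLeft D.basePoint_mem_chartLeft_source (m + 1)).symm
          (g.localClass (D.chartLeft D.basePoint)) ↔
      μM.localClass (D.i₁ (neckBaseVec m)) =
        (localHomology.chartXEquiv ℤ ℤ D.e₁ (D.i₁_mem (neckBaseVec m)) (m + 1)).symm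
          (g.localClass (D.e₁ (D.i₁ (neckBaseVec m)))) := by
  haveI := D.nonempty_A m.succ_ne_zero
  -- step 1: along `inl`
  have h1 := HomologicalOrientation.localClass_eq_chartXEquiv_symm_iff_of_map_eq g D.inlPH
    D.inlPH_source D.chartLeft (y := D.baseA) D.basePoint_mem_chartLeft_source
    (μM.restrictOpens D.A) μP (hL D.baseA)
  -- step 2: along `val : A → M`
  have h2 := HomologicalOrientation.localClass_eq_chartXEquiv_symm_iff_of_map_eq g
    (D.A.openPartialHomeomorphSubtypeCoe this) rfl D.e₁ (y := D.baseA)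
    (show ((D.baseA : D.A) : M) ∈ D.e₁.source from D.i₁_mem _) (μM.restrictOpens D.A) μM
    (HomologicalOrientation.map_val_restrictOpens_localClass μM D.A D.baseA)
  -- the two pulled-back charts coincide (both are `chartU`)
  have hc : D.inlPH.trans D.chartLeft = (D.A.openPartialHomeomorphSubtypeCoe this).trans D.e₁ :=
    D.inlPH_trans_chartLeft
  rw [localHomology.chartXEquiv_symm_congr hc _
    (show D.baseA ∈ ((D.A.openPartialHomeomorphSubtypeCoe this).trans D.e₁).source by
      rw [trans_source, TopologicalSpace.Opens.openPartialHomeomorphSubtypeCoe_source, univ_inter]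
      exact D.i₁_mem _)] at h1
  exact h1.symm.trans h2

omit [ChartedSpace (EuclideanSpace ℝ (Fin (m + 1))) M] in
/-- **Sign transfer along the second gluing map.** If `jB = inr` is orientation preserving from
`(N, μN)` to `(M # N, μP)`, then `μP` agrees with the reference class of `chartRight` at `p₀` iff
`μN` agrees with the reference class of `e₂` at `i₂ v₀`. [cite: HatcherAT2002, §3.3 pp. 231–236] -/
theorem localClass_basePoint_eq_iff_right
    (g : HomologicalOrientation ℤ (EuclideanSpace ℝ (Fin (m + 1))) (m + 1))
    (μN : HomologicalOrientation ℤ N (m + 1))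
    (μP : HomologicalOrientation ℤ (D.glueData m.succ_ne_zero).Glued (m + 1))
    (hR : D.neck.IsOrientedRight μN μP) :
    μP.localClass D.basePoint =
        (localHomology.chartXEquiv ℤ ℤ D.chartRight D.basePoint_mem_chartRight_source (m + 1)).symm
          (g.localClass (D.chartRight D.basePoint)) ↔
      μN.localClass (D.i₂ (neckBaseVec m)) =
        (localHomology.chartXEquiv ℤ ℤ D.e₂ (D.i₂_mem (neckBaseVec m)) (m + 1)).symm
          (g.localClass (D.e₂ (D.i₂ (neckBaseVec m)))) := by
  haveI := D.nonempty_B m.succ_ne_zero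
  rw [ConnectedSumNeck.isOrientedRight_iff] at hR
  have hb : (D.glueData m.succ_ne_zero).inr D.baseB ∈ D.chartRight.source := by
    rw [inr_baseB]; exact D.basePoint_mem_chartRight_source
  -- step 1: along `inr`
  have h1 := HomologicalOrientation.localClass_eq_chartXEquiv_symm_iff_of_map_eq g D.inrPH
    D.inrPH_source D.chartRight (y := D.baseB) hb (μN.restrictOpens D.B) μP (hR D.baseB)
  -- step 2: along `val : B → N`
  have h2 := HomologicalOrientation.localClass_eq_chartXEquiv_symm_iff_of_map_eq g
    (D.B.openPartialHomeomorphSubtypeCoe this) rfl D.e₂ (y := D.baseB)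
    (show ((D.baseB : D.B) : N) ∈ D.e₂.source by rw [coe_baseB]; exact D.i₂_mem _)
    (μN.restrictOpens D.B) μN
    (HomologicalOrientation.map_val_restrictOpens_localClass μN D.B D.baseB)
  have hc : D.inrPH.trans D.chartRight = (D.B.openPartialHomeomorphSubtypeCoe this).trans D.e₂ :=
    D.inrPH_trans_chartRight
  rw [localHomology.chartXEquiv_symm_congr hc _
    (show D.baseB ∈ ((D.B.openPartialHomeomorphSubtypeCoe this).trans D.e₂).source by
      rw [trans_source, TopologicalSpace.Opens.openPartialHomeomorphSubtypeCoe_source, univ_inter]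
      change ((D.baseB : D.B) : N) ∈ D.e₂.source
      rw [coe_baseB]; exact D.i₂_mem _)] at h1
  -- move the base points: `inr b₀ = p₀` and `b₀ = i₂ v₀`
  have e1 := HomologicalOrientation.agrees_congr_point μP g D.chartRight D.inr_baseB hb
    D.basePoint_mem_chartRight_source
  have e2 := HomologicalOrientation.agrees_congr_point μN g D.e₂ D.coe_baseB
    (show ((D.baseB : D.B) : N) ∈ D.e₂.source by rw [coe_baseB]; exact D.i₂_mem _)
    (D.i₂_mem (neckBaseVec m))
  exact e1.symm.trans (h1.symm.trans (h2.trans e2))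

/-- **The compatible orientation of `N` agrees with `e₂` at `i₂ v₀` iff `μM` does NOT agree with
`e₁` at `i₁ v₀`** (for `μP` compatible with both): the two neck charts have opposite reference
classes at `p₀`, and `(μP)_{p₀}` is one of them. [cite: Bredon1993, VI.7] -/
theorem right_agrees_iff_not_left_agrees
    (g : HomologicalOrientation ℤ (EuclideanSpace ℝ (Fin (m + 1))) (m + 1))
    (μM : HomologicalOrientation ℤ M (m + 1)) (μN : HomologicalOrientation ℤ N (m + 1))
    (μP : HomologicalOrientation ℤ (D.glueData m.succ_ne_zero).Glued (m + 1))
    (hL : D.neck.IsOrientedLeft μM μP) (hR : D.neck.IsOrientedRight μN μP) :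
    μN.localClass (D.i₂ (neckBaseVec m)) =
        (localHomology.chartXEquiv ℤ ℤ D.e₂ (D.i₂_mem (neckBaseVec m)) (m + 1)).symm
          (g.localClass (D.e₂ (D.i₂ (neckBaseVec m)))) ↔
      ¬ μM.localClass (D.i₁ (neckBaseVec m)) =
        (localHomology.chartXEquiv ℤ ℤ D.e₁ (D.i₁_mem (neckBaseVec m)) (m + 1)).symm
          (g.localClass (D.e₁ (D.i₁ (neckBaseVec m)))) := by
  rw [← D.localClass_basePoint_eq_iff_left g μM μP hL,
    ← D.localClass_basePoint_eq_iff_right g μN μP hR, D.chartXEquiv_symm_chartRight_eq_neg g]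
  have hgen := isGenerator_chartXEquiv_symm_localClass g D.chartLeft
    D.basePoint_mem_chartLeft_source (n := m + 1)
  constructor
  · intro h h'
    exact neg_ne_self_of_isGenerator hgen (h.symm.trans h')
  · intro h
    rcases eq_or_eq_neg_of_isGenerator (μP.isGenerator D.basePoint) hgen with h' | h'
    · exact absurd h' h
    · exact h'

end Signs

/-! ### §7 Reflecting the second chart flips the sign on `N` -/

section Reflect

/-- The side reflection as a partial homeomorphism of `ℝᵐ⁺¹` (source and target `univ`).
[folklore] -/
def sideReflectionPH (m : ℕ) :
    OpenPartialHomeomorph (EuclideanSpace ℝ (Fin (m + 1))) (EuclideanSpace ℝ (Fin (m + 1))) :=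
  (sideReflection m).toHomeomorph.toOpenPartialHomeomorph

/-- **The datum with the second chart reflected**: `(e₁, e₂ ≫ r)` for the side reflection `r`
(Kervaire–Milnor 1963, §2: replacing `i₂` by `i₂ ∘ r` reverses the orientation character of the
second disc). [cite: KervaireMilnorAnnals1963, §2 p. 505] -/
def reflectRight : TopConnectedSumData (m + 1) M N where
  e₁ := D.e₁
  e₂ := D.e₂ ≫ₕ sideReflectionPH m
  target₁ := D.target₁
  target₂ := by
    rw [trans_target, sideReflectionPH, Homeomorph.toOpenPartialHomeomorph_target, univ_inter,
      Homeomorph.toOpenPartialHomeomorph_symm_apply, D.target₂, preimage_univ]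

omit [T2Space M] [T2Space N] in
/-- The first chart is unchanged. [folklore] -/
@[simp] theorem reflectRight_e₁ : D.reflectRight.e₁ = D.e₁ := rfl

omit [T2Space M] [T2Space N] in
/-- The first disc is unchanged. [folklore] -/
@[simp] theorem reflectRight_i₁ : D.reflectRight.i₁ = D.i₁ := rfl

omit [T2Space M] [T2Space N] in
/-- The second chart is `e₂ ≫ r`. [folklore] -/
theorem reflectRight_e₂ : D.reflectRight.e₂ = D.e₂ ≫ₕ sideReflectionPH m := rfl

omit [T2Space M] [T2Space N] in
/-- The source of the reflected second chart is that of `e₂`. [folklore] -/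
theorem reflectRight_e₂_source : D.reflectRight.e₂.source = D.e₂.source := by
  rw [reflectRight_e₂, trans_source, sideReflectionPH, Homeomorph.toOpenPartialHomeomorph_source,
    preimage_univ, inter_univ]

omit [T2Space M] [T2Space N] in
/-- The second disc is `i₂ ∘ r`. [folklore] -/
theorem reflectRight_i₂_apply (w : EuclideanSpace ℝ (Fin (m + 1))) :
    D.reflectRight.i₂ w = D.i₂ (sideReflection m w) := by
  change D.e₂.symm ((sideReflection m).symm w) = D.e₂.symm (sideReflection m w)
  rw [sideReflection_symm]

omit [T2Space M] [T2Space N] in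
/-- The second disc is unchanged at the base point `v₀` (fixed by `r`). [folklore] -/
theorem reflectRight_i₂_neckBaseVec (hm : 1 ≤ m) :
    D.reflectRight.i₂ (neckBaseVec m) = D.i₂ (neckBaseVec m) := by
  rw [reflectRight_i₂_apply, sideReflection_neckBaseVec hm]

omit [T2Space M] in
/-- **Reflecting the chart negates its reference classes** (change of chart `r`, of Jacobian
determinant `-1`; Bredon 1993, VI.7). [cite: Bredon1993, VI.7] -/
theorem chartXEquiv_symm_reflectRight_e₂ [ChartedSpace (EuclideanSpace ℝ (Fin (m + 1))) N]
    (g : HomologicalOrientation ℤ (EuclideanSpace ℝ (Fin (m + 1))) (m + 1)) {y : N}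
    (hy : y ∈ D.e₂.source) (hy' : y ∈ D.reflectRight.e₂.source) :
    (localHomology.chartXEquiv ℤ ℤ D.reflectRight.e₂ hy' (m + 1)).symm
        (g.localClass (D.reflectRight.e₂ y)) =
      -(localHomology.chartXEquiv ℤ ℤ D.e₂ hy (m + 1)).symm (g.localClass (D.e₂ y)) := by
  -- the transition map `e₂ ∘ (e₂ ≫ r)⁻¹ = r`
  have htr : (fun v => D.e₂ (D.reflectRight.e₂.symm v)) = sideReflection m := by
    funext v
    change D.e₂ (D.e₂.symm ((sideReflection m).toHomeomorph.toOpenPartialHomeomorph.symm v)) = _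
    rw [D.e₂.right_inv (by rw [D.target₂]; trivial)]
    change (sideReflection m).symm v = _
    rw [sideReflection_symm]
  have hA : HasFDerivAt (fun v => D.e₂ (D.reflectRight.e₂.symm v))
      ((sideReflection m).toContinuousLinearEquiv :
        EuclideanSpace ℝ (Fin (m + 1)) →L[ℝ] EuclideanSpace ℝ (Fin (m + 1)))
      (D.reflectRight.e₂ y) := by
    rw [htr]
    exact ((sideReflection m).toContinuousLinearEquiv :
      EuclideanSpace ℝ (Fin (m + 1)) →L[ℝ] EuclideanSpace ℝ (Fin (m + 1))).hasFDerivAt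
  have hdet : LinearMap.det (((sideReflection m).toContinuousLinearEquiv :
      EuclideanSpace ℝ (Fin (m + 1)) →L[ℝ] EuclideanSpace ℝ (Fin (m + 1))) :
        EuclideanSpace ℝ (Fin (m + 1)) →ₗ[ℝ] EuclideanSpace ℝ (Fin (m + 1))) = -1 :=
    det_sideReflection m
  have key := chartXEquiv_symm_localClass_eq_of_hasFDerivAt g D.e₂ D.reflectRight.e₂ hy hy' hA
    (by rw [hdet]; norm_num)
  rw [hdet, if_neg (by norm_num)] at key
  exact key

omit [T2Space M] in
/-- **Reflecting the second chart flips whether `μN` agrees with it at `i₂ v₀`.**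
[cite: Bredon1993, VI.7] -/
theorem reflectRight_agrees_iff (hm : 1 ≤ m) [ChartedSpace (EuclideanSpace ℝ (Fin (m + 1))) N]
    (g : HomologicalOrientation ℤ (EuclideanSpace ℝ (Fin (m + 1))) (m + 1))
    (μN : HomologicalOrientation ℤ N (m + 1)) :
    μN.localClass (D.reflectRight.i₂ (neckBaseVec m)) =
        (localHomology.chartXEquiv ℤ ℤ D.reflectRight.e₂ (D.reflectRight.i₂_mem (neckBaseVec m))
          (m + 1)).symm (g.localClass (D.reflectRight.e₂ (D.reflectRight.i₂ (neckBaseVec m)))) ↔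
      ¬ μN.localClass (D.i₂ (neckBaseVec m)) =
        (localHomology.chartXEquiv ℤ ℤ D.e₂ (D.i₂_mem (neckBaseVec m)) (m + 1)).symm
          (g.localClass (D.e₂ (D.i₂ (neckBaseVec m)))) := by
  have hy' : D.i₂ (neckBaseVec m) ∈ D.reflectRight.e₂.source := by
    rw [reflectRight_e₂_source]; exact D.i₂_mem _
  rw [HomologicalOrientation.agrees_congr_point μN g D.reflectRight.e₂
    (D.reflectRight_i₂_neckBaseVec hm) (D.reflectRight.i₂_mem (neckBaseVec m)) hy',
    D.chartXEquiv_symm_reflectRight_e₂ g (D.i₂_mem _) hy']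
  exact μN.localClass_eq_neg_iff g D.e₂ (D.i₂_mem _)

end Reflect

/-! ### §8 Assembly: a topological connected sum oriented compatibly with both summands -/

section Assembly

variable [ChartedSpace (EuclideanSpace ℝ (Fin (m + 1))) M]
  [ChartedSpace (EuclideanSpace ℝ (Fin (m + 1))) N]

/-- **With the right choice of second chart, the compatible orientation of `N` is `μN` itself.**
If `μN` agrees with `e₂` at `i₂ v₀` exactly when `μM` does not agree with `e₁` at `i₁ v₀`, then
every orientation `μP₀` of the glued space can be corrected to an orientation `μP` under which
BOTH gluing maps are orientation preserving. [cite: KervaireMilnorAnnals1963, §2 p. 505] -/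
theorem exists_isOrientedLeft_isOrientedRight_of_agrees (hm : 1 ≤ m) [ConnectedSpace M]
    [ConnectedSpace N] (g : HomologicalOrientation ℤ (EuclideanSpace ℝ (Fin (m + 1))) (m + 1))
    (μM : HomologicalOrientation ℤ M (m + 1)) (μN : HomologicalOrientation ℤ N (m + 1))
    (μP₀ : HomologicalOrientation ℤ (D.glueData m.succ_ne_zero).Glued (m + 1))
    (hD : (μN.localClass (D.i₂ (neckBaseVec m)) =
        (localHomology.chartXEquiv ℤ ℤ D.e₂ (D.i₂_mem (neckBaseVec m)) (m + 1)).symm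
          (g.localClass (D.e₂ (D.i₂ (neckBaseVec m))))) ↔
      ¬ μM.localClass (D.i₁ (neckBaseVec m)) =
        (localHomology.chartXEquiv ℤ ℤ D.e₁ (D.i₁_mem (neckBaseVec m)) (m + 1)).symm
          (g.localClass (D.e₁ (D.i₁ (neckBaseVec m))))) :
    ∃ μP : HomologicalOrientation ℤ (D.glueData m.succ_ne_zero).Glued (m + 1),
      D.neck.IsOrientedLeft μM μP ∧ D.neck.IsOrientedRight μN μP := by
  haveI : ConnectedSpace (puncture D.neck.i₁) :=
    connectedSpace_puncture_of_isOpenEmbedding D.isOpenEmbedding_i₁ (by omega)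
  haveI : ConnectedSpace (puncture D.neck.i₂) :=
    connectedSpace_puncture_of_isOpenEmbedding D.isOpenEmbedding_i₂ (by omega)
  obtain ⟨μP, μN', -, hN', hL, hR⟩ := D.neck.exists_isOrientedLeft_isOrientedRight μM μN μP₀
  have key := D.right_agrees_iff_not_left_agrees g μM μN' μP hL hR
  rcases hN' with rfl | rfl
  · exact ⟨μP, hL, hR⟩
  · exfalso
    have h1 := μN.neg_localClass_eq_iff g D.e₂ (D.i₂_mem (neckBaseVec m))
    -- `key : s(-μN) ↔ ¬ sM`, `hD : sN ↔ ¬ sM`, `h1 : s(-μN) ↔ ¬ sN`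
    exact (not_iff_self (h1.symm.trans (key.trans hD.symm))).elim

/-- **A topological connected sum oriented compatibly with both summands exists.** For connected
compact Hausdorff topological `(m+1)`-manifolds `M`, `N` (`m ≥ 1`) with `ℤ`-orientations `μM`,
`μN`, provided every glued space `M # N` of a connected-sum datum is orientable (e.g. `M`, `N`
simply connected and `m ≥ 2`), there are a connected-sum datum `D` and an orientation `μP` of its
glued space under which both gluing maps are homologically orientation preserving — Kervaire and
Milnor's "`M₁ # M₂` oriented compatibly with `M₁` and `M₂`" (1963, §2 p. 505), the second disc
being replaced by its composite with a reflection when necessary.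
[cite: KervaireMilnorAnnals1963, §2 p. 505] -/
theorem exists_data_isOrientedLeft_isOrientedRight (hm : 1 ≤ m) [CompactSpace M] [CompactSpace N]
    [ConnectedSpace M] [ConnectedSpace N]
    (μM : HomologicalOrientation ℤ M (m + 1)) (μN : HomologicalOrientation ℤ N (m + 1))
    (horient : ∀ D : TopConnectedSumData (m + 1) M N,
      Nonempty (HomologicalOrientation ℤ (D.glueData m.succ_ne_zero).Glued (m + 1))) :
    ∃ (D : TopConnectedSumData (m + 1) M N)
      (μP : HomologicalOrientation ℤ (D.glueData m.succ_ne_zero).Glued (m + 1)),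
      D.neck.IsOrientedLeft μM μP ∧ D.neck.IsOrientedRight μN μP := by
  classical
  obtain ⟨g⟩ := isOrientableOver_of_simplyConnectedSpace ℤ (EuclideanSpace ℝ (Fin (m + 1)))
    (n := m + 1)
  obtain ⟨D₀⟩ := nonempty_topConnectedSumData (n := m + 1) (M := M) (N := N)
  by_cases h : (μN.localClass (D₀.i₂ (neckBaseVec m)) =
        (localHomology.chartXEquiv ℤ ℤ D₀.e₂ (D₀.i₂_mem (neckBaseVec m)) (m + 1)).symm
          (g.localClass (D₀.e₂ (D₀.i₂ (neckBaseVec m))))) ↔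
      ¬ μM.localClass (D₀.i₁ (neckBaseVec m)) =
        (localHomology.chartXEquiv ℤ ℤ D₀.e₁ (D₀.i₁_mem (neckBaseVec m)) (m + 1)).symm
          (g.localClass (D₀.e₁ (D₀.i₁ (neckBaseVec m))))
  · obtain ⟨μP₀⟩ := horient D₀
    obtain ⟨μP, hL, hR⟩ := D₀.exists_isOrientedLeft_isOrientedRight_of_agrees hm g μM μN μP₀ h
    exact ⟨D₀, μP, hL, hR⟩
  · obtain ⟨μP₀⟩ := horient D₀.reflectRight
    have h' := D₀.reflectRight_agrees_iff hm g μN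
    obtain ⟨μP, hL, hR⟩ := D₀.reflectRight.exists_isOrientedLeft_isOrientedRight_of_agrees hm g
      μM μN μP₀ (h'.trans (not_iff.1 h))
    exact ⟨D₀.reflectRight, μP, hL, hR⟩

end Assembly

end TopConnectedSumData

/-! ### §9 Dimension four: `Q_{M # N} ≅ Q_M ⊥ Q_N` (closed simply connected TOP 4-manifolds) -/

/-- **The intersection form of a topological connected sum is the orthogonal sum of the forms of
the summands** (topological category). For closed simply connected topological 4-manifolds `M`,
`N` in `Type` with `ℤ`-orientations `μM`, `μN` and isometries `Q⟦μM⟧ ≅ B₁`, `Q⟦μN⟧ ≅ B₂`, there is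
a closed simply connected topological 4-manifold `P` in `Type` which is a topological connected
sum `M # N` (`IsTopConnectedSum`), with a `ℤ`-orientation `μP` and an isometry
`Q⟦μP⟧ ≅ B₁ ⊥ B₂` (Mathlib's `LinearMap.BilinForm.Equivalent`, the tree's `prod`). The glued
space of a connected-sum datum whose second chart is reflected if necessary (§8); simply
connected by Seifert–van Kampen (`IsTopConnectedSum.simplyConnectedSpace`), hence `ℤ`-orientable
(Hatcher Prop. 3.25), and the decomposition of `ConnectedSumCohomology.lean`
(`ConnectedSumNeck.exists_decomposition_intersectionForm`: Wall 1964, pp. 144–145) along the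
orientation-preserving gluing maps. This is the topological form of
`exists_isConnectedSum_intersectionForm_equivalent_prod` (Freedman–Quinn 1990, §10.2A: forms
add under `#`; used with non-smoothable summands such as `‖E₈‖` in §10.1, §10.3).
[cite: FreedmanQuinnPMS1990, §10.2A (p. 162) and §10.3 (pp. 165–166)]
[cite: KervaireMilnorAnnals1963, §2 p. 505] [cite: WallJLMS1964, §2 pp. 144–145] -/
theorem exists_isTopConnectedSum_intersectionForm_equivalent_prod (M N : Type)
    [TopologicalSpace M] [T2Space M] [SecondCountableTopology M]
    [ChartedSpace (EuclideanSpace ℝ (Fin 4)) M] [CompactSpace M] [SimplyConnectedSpace M]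
    [TopologicalSpace N] [T2Space N] [SecondCountableTopology N]
    [ChartedSpace (EuclideanSpace ℝ (Fin 4)) N] [CompactSpace N] [SimplyConnectedSpace N]
    (μM : HomologicalOrientation ℤ M 4) (μN : HomologicalOrientation ℤ N 4)
    {W₁ W₂ : Type*} [AddCommGroup W₁] [AddCommGroup W₂]
    {B₁ : LinearMap.BilinForm ℤ W₁} {B₂ : LinearMap.BilinForm ℤ W₂}
    (h₁ : (intersectionForm two_add_two_eq_four μM).Equivalent B₁)
    (h₂ : (intersectionForm two_add_two_eq_four μN).Equivalent B₂) :
    ∃ (P : Type) (_ : TopologicalSpace P) (_ : T2Space P) (_ : SecondCountableTopology P)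
      (_ : ChartedSpace (EuclideanSpace ℝ (Fin 4)) P) (_ : CompactSpace P)
      (_ : SimplyConnectedSpace P)
      (μP : HomologicalOrientation ℤ P 4),
      IsTopConnectedSum (EuclideanSpace ℝ (Fin 4)) M N P ∧
        (intersectionForm two_add_two_eq_four μP).Equivalent (B₁.prod B₂) := by
  -- every glued space is a topological connected sum of `M` and `N`, hence simply connected
  have hsum : ∀ D : TopConnectedSumData (3 + 1) M N,
      IsTopConnectedSum (EuclideanSpace ℝ (Fin (3 + 1))) M N
        (D.glueData (Nat.succ_ne_zero 3)).Glued :=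
    fun D => ⟨D.i₁, D.i₂, D.isOpenEmbedding_i₁, D.isOpenEmbedding_i₂,
      (D.glueData (Nat.succ_ne_zero 3)).isTopOpenGluing
        (D.connectedSumRel_iff_φ (Nat.succ_ne_zero 3))⟩
  have hsc : ∀ D : TopConnectedSumData (3 + 1) M N,
      SimplyConnectedSpace (D.glueData (Nat.succ_ne_zero 3)).Glued :=
    fun D => (hsum D).simplyConnectedSpace (by norm_num)
  -- hence orientable
  have horient : ∀ D : TopConnectedSumData (3 + 1) M N,
      Nonempty (HomologicalOrientation ℤ (D.glueData (Nat.succ_ne_zero 3)).Glued (3 + 1)) := by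
    intro D
    haveI := hsc D
    exact isOrientableOver_of_simplyConnectedSpace ℤ (D.glueData (Nat.succ_ne_zero 3)).Glued
  -- a datum with compatibly oriented glued space
  obtain ⟨D, μP, hL, hR⟩ := TopConnectedSumData.exists_data_isOrientedLeft_isOrientedRight
    (m := 3) (by norm_num) μM μN horient
  haveI := hsc D
  haveI : SecondCountableTopology (D.glueData (Nat.succ_ne_zero 3)).Glued :=
    (D.glueData (Nat.succ_ne_zero 3)).secondCountableTopology (EuclideanSpace ℝ (Fin (3 + 1)))
  -- the decomposition of the intersection form
  obtain ⟨sM, sN, -, -, -, hbij, hQ⟩ :=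
    D.neck.exists_decomposition_intersectionForm (m := 3) (by norm_num) le_rfl two_add_two_eq_four
      hL hR
  obtain ⟨e₁⟩ := h₁
  obtain ⟨e₂⟩ := h₂
  refine ⟨(D.glueData (Nat.succ_ne_zero 3)).Glued, inferInstance, inferInstance, inferInstance,
    inferInstance, inferInstance, inferInstance, μP, hsum D, ⟨?_⟩⟩
  -- the isometry `x ↦ (e₁ (sM x), e₂ (sN x))`
  let F : ↥(freeCohomology ℤ (D.glueData (Nat.succ_ne_zero 3)).Glued 2) →ₗ[ℤ] W₁ × W₂ :=
    ((e₁ : ↥(freeCohomology ℤ M 2) ≃ₗ[ℤ] W₁).toLinearMap.comp sM).prod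
      ((e₂ : ↥(freeCohomology ℤ N 2) ≃ₗ[ℤ] W₂).toLinearMap.comp sN)
  have hF : Function.Bijective F :=
    ((e₁ : ↥(freeCohomology ℤ M 2) ≃ₗ[ℤ] W₁).bijective.prodMap
      (e₂ : ↥(freeCohomology ℤ N 2) ≃ₗ[ℤ] W₂).bijective).comp hbij
  exact
    { toLinearEquiv := LinearEquiv.ofBijective F hF
      map_app' := fun x y => by
        change (B₁.prod B₂) (e₁ (sM x), e₂ (sN x)) (e₁ (sM y), e₂ (sN y)) = _
        rw [LinearMap.BilinForm.prod_apply, e₁.map_app, e₂.map_app]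
        exact (hQ x y).symm }

end Literature.Topology.FourManifolds
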